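import Summits.ValiantsHypothesis.ValiantsHypothesis.Theorems.LacunarySymmetroidMatrixDescartesDoorA26WallBubblingConfluentNondeg

/-!
# Wall bubbling for `DoorA26` — (W-split) structure, part B1: THE SLOT COUNT OF A CONFLUENT DETERMINANT IN MEMBER LANGUAGE (Laguerre–Pólya, with multiplicity)

HONEST FRAMING.  Chain lemma for obligation (W) `stub_weylFaces` of `Cruxes/DoorA26/Lines/wall_bubbling.lean` (stmt-ValiantsHypothesis-19979
`DoorA26`; OPEN, typed, never asserted), W2 seat val-sym-door-p1 g15; statement file `Cruxes/DoorA26/Lines/wall_bubbling_ConfluentDoor.lean` rev 4,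
named residual «(W-split) multi-scale linking».  The `hcount` input of the count `chain_ceiling` (#17) for ONE confluent limit, stated WITHOUT
existential slot polynomials: in the language of the polar Gram entries `polar(W_p, W_q)` of the limit letters that the cluster packages of part A
(`…ConfluentClusters.confluentClusters`) deliver.

* `exists_polar_ne_zero_of_confluentDet_ne_zero` — a confluent determinant `det(e^{δ₀t}(W₀ + tW₅) + Σ_k e^{δ_{k+1}t}W_{k+1})` that is not identically
  zero has an ALIVE member `polar(W_p, W_q) ≠ 0` (the quadratic-form identity #14 `confluentDet_eq_quadForm`).
* **`confluentDet_zerosWithMultiplicityLE_slots`** — if it is not identically zero, its real zeros COUNTED WITH MULTIPLICITY number at most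
  `S − 1`, where `S = Σ_{w ∈ Λ} (d w + 1)` is the MEMBER-LANGUAGE SLOT COUNT: `Λ` = the pair-sum values `w = δ₀_p + δ₀_q` carrying an alive member,
  `d w = 2` if `w = 2δ₀_0` and the `t²`-slot `polar(W₅,W₅)` is alive, `d w = 1` if some confluent `t`-slot `polar(W₅,W_q)` (`q ≠ 5`) of value `w`
  is alive, `d w = 0` otherwise.  NO 2-Sidon hypothesis (the bound only over-counts off the generic face).  Proof = W1 #12's Laguerre–Pólya count
  `extSum_zerosWithMultiplicity_le` (p-landed in `…ConfluentCount`) on the slot polynomials `P_w = Σ_{δ₀p+δ₀q=w} polar(W_p,W_q)·X^{[p=5]+[q=5]}`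
  of #14, with the two facts «all members of the class dead ⇒ `P_w = 0`» and «`deg P_w ≤ d w`».

At a generic Weyl face (`δ0 ∘ castSucc` 2-Sidon) `S` is the true extended span `Σ(deg + 1)`; in the tight-chain theorem (part B2 `…TightChain`) the
squeeze `20 = Σ_c m_c ≤ Σ_c (S_c − 1) ≤ 20` turns the inequality into `m_c + 1 = S_c` per cluster.

No new definitions; nothing here bears on `DoorA26`, `MatrixDescartes` (stmt-ValiantsHypothesis-18050) or `VP ≠ VNP`; (W)/(W-split)/`ConfluentDoor26` OPEN.

[folklore: Laguerre 1898; Pólya–Szegő 1976 Part V §1, §75]  [this work] the member-language slot bookkeeping.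
-/

-- `Summit.ValiantsHypothesis.ValiantsHypothesis.…` repeats a component by the D-0017 layout
-- (single-conjunct summit), which the `dupNamespace` linter flags; the name is mandated.
set_option linter.dupNamespace false

namespace Summit.ValiantsHypothesis.ValiantsHypothesis.Theorems.LacunarySymmetroidMatrixDescartes.WallBubbling

open Finset Filter Topology Polynomial
open Bubbling (polar polar_comm extSum_zerosWithMultiplicity_le)
open Literature.Analysis.TotalPositivity.LaguerreRuleOfSigns (ZerosWithMultiplicityLE)
open scoped BigOperators

/-- **A confluent determinant that is not identically zero has an alive member.** [this work] -/
theorem exists_polar_ne_zero_of_confluentDet_ne_zero (δ0 : Fin 6 → ℝ) (W : Fin 6 → Matrix (Fin 2) (Fin 2) ℝ)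
    (hne : ∃ t, ((Real.exp (δ0 0 * t)) • (W 0 + t • W 5)
      + ∑ k : Fin 4, (Real.exp (δ0 k.succ.castSucc * t)) • W k.succ.castSucc).det ≠ 0) :
    ∃ p q, polar (W p) (W q) ≠ 0 := by
  by_contra h
  push Not at h
  obtain ⟨t, ht⟩ := hne
  apply ht
  rw [confluentDet_eq_quadForm]
  exact Finset.sum_eq_zero fun p _ => Finset.sum_eq_zero fun q _ => by rw [h p q, zero_mul]

/-- **THE SLOT COUNT OF A CONFLUENT DETERMINANT, IN MEMBER LANGUAGE (Laguerre–Pólya with multiplicity).**  See the module docstring: if the confluent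
determinant of `W` (Weyl pair at the positions `0, 5`, `δ0 5 = δ0 0`) is not identically zero, its real zeros counted with multiplicity number at most
`Σ_{w ∈ Λ}(d w + 1) − 1` with the alive value set `Λ` and the member-language degrees `d`. [this work] -/
theorem confluentDet_zerosWithMultiplicityLE_slots (δ0 : Fin 6 → ℝ) (h05 : δ0 5 = δ0 0) (W : Fin 6 → Matrix (Fin 2) (Fin 2) ℝ)
    (hne : ∃ t, ((Real.exp (δ0 0 * t)) • (W 0 + t • W 5)
      + ∑ k : Fin 4, (Real.exp (δ0 k.succ.castSucc * t)) • W k.succ.castSucc).det ≠ 0) :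
    ZerosWithMultiplicityLE
      (fun t => ((Real.exp (δ0 0 * t)) • (W 0 + t • W 5) + ∑ k : Fin 4, (Real.exp (δ0 k.succ.castSucc * t)) • W k.succ.castSucc).det)
      Set.univ
      ((∑ w ∈ ((univ : Finset (Fin 6 × Fin 6)).image (fun pq => δ0 pq.1 + δ0 pq.2)).filter
          (fun w => ∃ p q : Fin 6, δ0 p + δ0 q = w ∧ polar (W p) (W q) ≠ 0),
        ((if δ0 0 + δ0 0 = w ∧ polar (W 5) (W 5) ≠ 0 then 2
          else if (∃ q : Fin 6, q ≠ 5 ∧ δ0 5 + δ0 q = w ∧ polar (W 5) (W q) ≠ 0) then 1 else 0) + 1)) - 1) := by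
  classical
  set V : Finset ℝ := (univ : Finset (Fin 6 × Fin 6)).image (fun pq => δ0 pq.1 + δ0 pq.2) with hV
  have hmemV : ∀ p q : Fin 6, δ0 p + δ0 q ∈ V := fun p q => Finset.mem_image.mpr ⟨(p, q), Finset.mem_univ _, rfl⟩
  -- the slot polynomials
  set P : ℝ → ℝ[X] := fun w => ∑ p : Fin 6, ∑ q : Fin 6,
    if δ0 p + δ0 q = w then C (polar (W p) (W q)) * X ^ ((if p = 5 then 1 else 0) + (if q = 5 then 1 else 0)) else 0 with hP
  -- (a) the extended sum is the confluent determinant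
  have hrep : ∀ t : ℝ, ∑ w ∈ V, (P w).eval t * Real.exp (w * t)
      = ((Real.exp (δ0 0 * t)) • (W 0 + t • W 5) + ∑ k : Fin 4, (Real.exp (δ0 k.succ.castSucc * t)) • W k.succ.castSucc).det := by
    intro t
    rw [confluentDet_eq_quadForm]
    have h1 : ∀ w ∈ V, (P w).eval t * Real.exp (w * t)
        = ∑ p : Fin 6, ∑ q : Fin 6, if δ0 p + δ0 q = w then
            polar (W p) (W q) * t ^ ((if p = 5 then 1 else 0) + (if q = 5 then 1 else 0)) * Real.exp (w * t) else 0 := by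
      intro w _
      rw [hP]
      simp only [eval_finsetSum, Finset.sum_mul]
      refine Finset.sum_congr rfl fun p _ => Finset.sum_congr rfl fun q _ => ?_
      by_cases hv : δ0 p + δ0 q = w
      · rw [if_pos hv, if_pos hv, eval_mul, eval_C, eval_pow, eval_X]
      · rw [if_neg hv, if_neg hv, eval_zero, zero_mul]
    rw [Finset.sum_congr rfl h1, Finset.sum_comm]
    refine Finset.sum_congr rfl fun p _ => ?_
    rw [Finset.sum_comm]
    refine Finset.sum_congr rfl fun q _ => ?_
    rw [Finset.sum_ite_eq V (δ0 p + δ0 q), if_pos (hmemV p q)]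
    -- the slot function of the pair `(p,q)`
    by_cases hp : p = 5 <;> by_cases hq : q = 5
    · subst hp; subst hq
      simp only [if_true, dslope_exp_same, h05]
      rw [show (δ0 0 + δ0 0) * t = δ0 0 * t + δ0 0 * t by ring, Real.exp_add]; ring
    · subst hp
      simp only [if_true, if_neg hq, dslope_exp_same, h05]
      rw [show (δ0 0 + δ0 q) * t = δ0 0 * t + δ0 q * t by ring, Real.exp_add]; ring
    · subst hq
      simp only [if_true, if_neg hp, dslope_exp_same, h05]
      rw [show (δ0 p + δ0 0) * t = δ0 p * t + δ0 0 * t by ring, Real.exp_add]; ring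
    · simp only [if_neg hp, if_neg hq]
      rw [show (δ0 p + δ0 q) * t = δ0 p * t + δ0 q * t by ring, Real.exp_add]; ring
  -- (b) a class all of whose members are dead has the zero slot polynomial
  have hdead : ∀ w, (¬ ∃ p q : Fin 6, δ0 p + δ0 q = w ∧ polar (W p) (W q) ≠ 0) → P w = 0 := by
    intro w hw
    push Not at hw
    rw [hP]
    refine Finset.sum_eq_zero fun p _ => Finset.sum_eq_zero fun q _ => ?_
    by_cases hv : δ0 p + δ0 q = w
    · rw [if_pos hv, hw p q hv, C_0, zero_mul]
    · rw [if_neg hv]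
  -- (c) degree bounds in member language
  have hdeg : ∀ w, (P w).natDegree ≤
      (if δ0 0 + δ0 0 = w ∧ polar (W 5) (W 5) ≠ 0 then 2
        else if (∃ q : Fin 6, q ≠ 5 ∧ δ0 5 + δ0 q = w ∧ polar (W 5) (W q) ≠ 0) then 1 else 0) := by
    intro w
    rw [hP]
    refine natDegree_sum_le_of_forall_le _ _ fun p _ => natDegree_sum_le_of_forall_le _ _ fun q _ => ?_
    by_cases hv : δ0 p + δ0 q = w
    · rw [if_pos hv]
      by_cases hz : polar (W p) (W q) = 0
      · rw [hz, C_0, zero_mul, natDegree_zero]; exact Nat.zero_le _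
      refine (natDegree_C_mul_X_pow_le _ _).trans ?_
      by_cases hp : p = 5 <;> by_cases hq : q = 5
      · -- the `t²`-slot `(5,5)`
        have hw : δ0 0 + δ0 0 = w := by rw [← hv, hp, hq, h05]
        have hz' : polar (W 5) (W 5) ≠ 0 := by rwa [hp, hq] at hz
        rw [if_pos hp, if_pos hq, if_pos ⟨hw, hz'⟩]
      · -- a confluent `t`-slot `(5,q)`
        have h2 : ∃ q' : Fin 6, q' ≠ 5 ∧ δ0 5 + δ0 q' = w ∧ polar (W 5) (W q') ≠ 0 :=
          ⟨q, hq, by rw [← hv, hp], by rwa [hp] at hz⟩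
        rw [if_pos hp, if_neg hq]
        by_cases h1 : δ0 0 + δ0 0 = w ∧ polar (W 5) (W 5) ≠ 0
        · rw [if_pos h1]; norm_num
        · rw [if_neg h1, if_pos h2]
      · -- a confluent `t`-slot `(p,5)`
        have h2 : ∃ q' : Fin 6, q' ≠ 5 ∧ δ0 5 + δ0 q' = w ∧ polar (W 5) (W q') ≠ 0 :=
          ⟨p, hp, by rw [← hv, hq, add_comm], by rw [polar_comm]; rwa [hq] at hz⟩
        rw [if_neg hp, if_pos hq]
        by_cases h1 : δ0 0 + δ0 0 = w ∧ polar (W 5) (W 5) ≠ 0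
        · rw [if_pos h1]; norm_num
        · rw [if_neg h1, if_pos h2]
      · rw [if_neg hp, if_neg hq]; exact Nat.zero_le _
    · rw [if_neg hv, natDegree_zero]; exact Nat.zero_le _
  -- (d) an active class
  have hact : ∃ w ∈ V, P w ≠ 0 := by
    by_contra h
    push Not at h
    obtain ⟨t, ht⟩ := hne
    exact ht (by rw [← hrep t]; exact Finset.sum_eq_zero fun w hw => by rw [h w hw, eval_zero, zero_mul])
  -- (e) the slot bound
  have hslots : (∑ w ∈ V, if P w = 0 then 0 else (P w).natDegree + 1)
      ≤ ∑ w ∈ V.filter (fun w => ∃ p q : Fin 6, δ0 p + δ0 q = w ∧ polar (W p) (W q) ≠ 0),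
        ((if δ0 0 + δ0 0 = w ∧ polar (W 5) (W 5) ≠ 0 then 2
          else if (∃ q : Fin 6, q ≠ 5 ∧ δ0 5 + δ0 q = w ∧ polar (W 5) (W q) ≠ 0) then 1 else 0) + 1) := by
    rw [Finset.sum_filter]
    refine Finset.sum_le_sum fun w _ => ?_
    by_cases hPw : P w = 0
    · rw [if_pos hPw]; exact Nat.zero_le _
    · have halive : ∃ p q : Fin 6, δ0 p + δ0 q = w ∧ polar (W p) (W q) ≠ 0 := by
        by_contra h; exact hPw (hdead w h)
      rw [if_neg hPw, if_pos halive]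
      exact Nat.add_le_add_right (hdeg w) 1
  -- the bound is at least one
  have hone : 1 ≤ ∑ w ∈ V.filter (fun w => ∃ p q : Fin 6, δ0 p + δ0 q = w ∧ polar (W p) (W q) ≠ 0),
        ((if δ0 0 + δ0 0 = w ∧ polar (W 5) (W 5) ≠ 0 then 2
          else if (∃ q : Fin 6, q ≠ 5 ∧ δ0 5 + δ0 q = w ∧ polar (W 5) (W q) ≠ 0) then 1 else 0) + 1) := by
    obtain ⟨w₀, hw₀V, hw₀⟩ := hact
    have halive : ∃ p q : Fin 6, δ0 p + δ0 q = w₀ ∧ polar (W p) (W q) ≠ 0 := by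
      by_contra h; exact hw₀ (hdead w₀ h)
    have hmem : w₀ ∈ V.filter (fun w => ∃ p q : Fin 6, δ0 p + δ0 q = w ∧ polar (W p) (W q) ≠ 0) :=
      Finset.mem_filter.mpr ⟨hw₀V, halive⟩
    refine le_trans ?_ (Finset.single_le_sum
      (f := fun w => (if δ0 0 + δ0 0 = w ∧ polar (W 5) (W 5) ≠ 0 then 2
          else if (∃ q : Fin 6, q ≠ 5 ∧ δ0 5 + δ0 q = w ∧ polar (W 5) (W q) ≠ 0) then 1 else 0) + 1)
      (fun w _ => Nat.zero_le _) hmem)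
    exact Nat.le_add_left 1 _
  rw [show (fun t => ((Real.exp (δ0 0 * t)) • (W 0 + t • W 5)
      + ∑ k : Fin 4, (Real.exp (δ0 k.succ.castSucc * t)) • W k.succ.castSucc).det)
      = (fun t => ∑ w ∈ V, (P w).eval t * Real.exp (w * t)) from funext fun t => (hrep t).symm]
  exact extSum_zerosWithMultiplicity_le _ V P hact (by omega)

end Summit.ValiantsHypothesis.ValiantsHypothesis.Theorems.LacunarySymmetroidMatrixDescartes.WallBubbling
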